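import Literature.AlgebraicGeometry.Resolution.FieldsJ2
import Literature.AlgebraicGeometry.Resolution.SmoothUniformizationProofs
import Literature.AlgebraicGeometry.Resolution.ExcellentRings
import Mathlib.RingTheory.Localization.BaseChange
import HarnessLib

/-!
# J-2 from finite J-0 covers of the residue fields (Stacks 07PB, 07PC)

Topic: `Literature/AlgebraicGeometry/Resolution`. The reduction used by Stacks 07PJ to prove that
complete local rings (and Dedekind domains, …) are J-2, for the discharge of `Stacks07QW_complete`
(`ExcellentRings.lean`). Stacks, Tag 07PC: for a Noetherian ring `R`, "(1) `R` is J-2, (2) every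
finite type `R`-algebra which is a domain is J-0, (3) every finite `R`-algebra is J-1, (4) for
every prime `𝔭` and every finite purely inseparable extension `L/κ(𝔭)` there exists a finite
`R`-algebra `R'` which is a domain, which is J-0, and whose field of fractions is `L`" are
equivalent. We prove (4) ⇒ (2) ⇒ (1) as printed ((2) ⇒ (1) is Nagata's criterion 07P9 =
Matsumura Thm. 24.4, `NagataCriterion.lean`; (4) ⇒ (2) uses 04KM
`exists_purelyInseparable_isSeparablyGenerated`, 07PB and 07PA
`exists_ne_zero_forall_isRegularLocalRing_of_finite` of `FieldsJ2.lean`), with (4) phrased for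
all finite extensions `l` of `Frac(R/𝔭)` given with their algebra structures (the form produced
by 04KM and consumed by `ExcellentRingsCompleteHolds.lean`), and 07PB (J-0 goes up along finite
type extensions with separably generated fraction field extension) from EGA IV₄ 17.5.8 (iii)
(`Grothendieck1967_17_5_8_holds`, `SmoothUniformizationProofs.lean`). Everything is PROVED.

## Content

* `exists_ne_zero_forall_isRegularLocalRing_of_finiteType_formallySmooth` — Stacks 07PB.
* `IntermediateField.fg_top_of_isFractionRing_of_finiteType_domain` — `Frac S` is finitely
  generated over `Frac R₀` for `S` of finite type over the domain `R₀`.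
* `exists_ne_zero_forall_isRegularLocalRing_of_finiteType_of_forall_exists_finite` — 07PC,
  (4) ⇒ (2); `isJ2Ring_of_forall_exists_finite` — 07PC, (4) ⇒ (1).

## Sources

* The Stacks Project, More on Algebra, Section 07P6: Tags 07PB, 07PC, 07PA, 07P9; Algebra,
  Tag 04KM, Tag 07ND. [StacksProject]
* H. Matsumura, *Commutative Ring Theory*, CUP 1986, Thm. 24.4 (Nagata's criterion).
  [Matsumura1987]
-/

noncomputable section

open IsLocalRing

namespace Literature.AlgebraicGeometry.Resolution

universe u

/-! ## Stacks 07PB for finite type extensions -/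

/-- **Stacks 07PB (J-0 goes up along finite type extensions with separable fraction field
extension)**: let `R ⊆ S` be Noetherian domains with `S` of finite type over `R`, `R` J-0, and
`Frac S` formally smooth (e.g. separably generated) over `Frac R`. Then `S` is J-0. Printed
proof: "We may replace `R` by a principal localization and assume `R` is a regular ring. By
Algebra, Lemma 07ND the ring map `R → S` is smooth at `(0)`. Hence after replacing `S` by a
principal localization we may assume that `S` is smooth over `R`. Then `S` is regular too".
Here: `S` is smooth over `R` at the generic point (`S_(0) = Frac S` is formally smooth over
`R`), the smooth locus is open, and at a prime of the smooth locus lying over a regular prime of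
`R` the local ring is regular by EGA IV₄ 17.5.8 (iii) (`Grothendieck1967_17_5_8_holds`).
[cite: StacksProject, Tag 07PB] -/
theorem exists_ne_zero_forall_isRegularLocalRing_of_finiteType_formallySmooth
    (R S K L : Type u) [CommRing R] [IsDomain R] [IsNoetherianRing R] [CommRing S] [IsDomain S]
    [Algebra R S] [Algebra.FiniteType R S] [FaithfulSMul R S] [Field K] [Field L] [Algebra R K]
    [IsFractionRing R K] [Algebra S L] [IsFractionRing S L] [Algebra K L] [Algebra R L]
    [IsScalarTower R K L] [IsScalarTower R S L] [Algebra.FormallySmooth K L]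
    (hR : ∃ g : R, g ≠ 0 ∧ ∀ (Q : Ideal R) [Q.IsPrime], g ∉ Q →
      IsRegularLocalRing (Localization.AtPrime Q)) :
    ∃ f : S, f ≠ 0 ∧ ∀ (P : Ideal S) [P.IsPrime], f ∉ P →
      IsRegularLocalRing (Localization.AtPrime P) := by
  classical
  haveI : Algebra.FinitePresentation R S := (Algebra.FinitePresentation.of_finiteType).mp ‹_›
  -- smooth at the generic point
  haveI : Algebra.FormallySmooth R K := Algebra.FormallySmooth.of_isLocalization (nonZeroDivisors R)
  haveI : Algebra.FormallySmooth R L := Algebra.FormallySmooth.comp R K L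
  have hbot : Algebra.IsSmoothAt R (⊥ : Ideal S) := by
    haveI : IsLocalization (nonZeroDivisors S) (Localization.AtPrime (⊥ : Ideal S)) := by
      rw [← Ideal.primeCompl_bot]
      infer_instance
    let e : Localization.AtPrime (⊥ : Ideal S) ≃ₐ[S] L :=
      IsLocalization.algEquiv (nonZeroDivisors S) (Localization.AtPrime (⊥ : Ideal S)) L
    exact Algebra.FormallySmooth.of_equiv (e.restrictScalars R).symm
  -- a basic open inside the smooth locus
  let ξ : PrimeSpectrum S := ⟨⊥, Ideal.isPrime_bot⟩
  have hξ : ξ ∈ Algebra.smoothLocus R S := hbot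
  obtain ⟨_, ⟨f, rfl⟩, hξf, hfsub⟩ :=
    PrimeSpectrum.isTopologicalBasis_basic_opens.exists_subset_of_mem_open hξ
      Algebra.isOpen_smoothLocus
  have hf0 : f ≠ 0 := fun h0 => by
    rw [SetLike.mem_coe, PrimeSpectrum.mem_basicOpen] at hξf
    exact hξf (show f ∈ (⊥ : Ideal S) from h0.symm ▸ Submodule.zero_mem _)
  obtain ⟨g, hg0, hg⟩ := hR
  have hg0' : algebraMap R S g ≠ 0 := (map_ne_zero_iff _ (FaithfulSMul.algebraMap_injective R S)).mpr hg0
  refine ⟨f * algebraMap R S g, mul_ne_zero hf0 hg0', fun P _ hP => ?_⟩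
  have hfP : f ∉ P := fun h => hP (P.mul_mem_right _ h)
  have hgP : g ∉ P.comap (algebraMap R S) := fun h => hP (P.mul_mem_left _ h)
  haveI : Algebra.IsSmoothAt R P :=
    hfsub (show (⟨P, ‹_›⟩ : PrimeSpectrum S) ∈ (PrimeSpectrum.basicOpen f : Set _) from hfP)
  haveI := hg (P.comap (algebraMap R S)) hgP
  exact (Grothendieck1967_17_5_8_holds R S ‹_› P ‹_›).mpr ‹_›

/-! ## The fraction field of a finite type algebra over a domain is finitely generated -/

/-- For a domain `C` of finite type over a domain `R₀`, `Frac C` is finitely generated over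
`Frac R₀` as a field (by the images of algebra generators). [folklore] -/
theorem IntermediateField.fg_top_of_isFractionRing_of_finiteType_domain (R₀ C K₀ K : Type u)
    [CommRing R₀] [CommRing C] [IsDomain C] [Algebra R₀ C] [Algebra.FiniteType R₀ C]
    [Field K₀] [Algebra R₀ K₀] [Field K] [Algebra C K] [IsFractionRing C K] [Algebra R₀ K]
    [Algebra K₀ K] [IsScalarTower R₀ C K] [IsScalarTower R₀ K₀ K] :
    (⊤ : IntermediateField K₀ K).FG := by
  classical
  obtain ⟨s, hs⟩ := ‹Algebra.FiniteType R₀ C›.out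
  let φ : C →ₐ[R₀] K := IsScalarTower.toAlgHom R₀ C K
  refine ⟨s.image φ, ?_⟩
  have hC : ∀ c : C,
      algebraMap C K c ∈ IntermediateField.adjoin K₀ ((s.image φ : Finset K) : Set K) := by
    intro c
    have hc : c ∈ Algebra.adjoin R₀ (s : Set C) := hs ▸ Algebra.mem_top
    have h1 : φ c ∈ (Algebra.adjoin R₀ (s : Set C)).map φ := ⟨c, hc, rfl⟩
    rw [AlgHom.map_adjoin] at h1
    rw [Finset.coe_image]
    have h2 : Algebra.adjoin R₀ (φ '' (s : Set C)) ≤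
        (IntermediateField.adjoin K₀ (φ '' (s : Set C))).toSubalgebra.restrictScalars R₀ :=
      Algebra.adjoin_le fun x hx => IntermediateField.subset_adjoin K₀ _ hx
    exact h2 h1
  refine eq_top_iff.mpr fun z _ => ?_
  obtain ⟨a, b, -, rfl⟩ := IsFractionRing.div_surjective (A := C) z
  exact div_mem (hC a) (hC b)

/-! ## Stacks 07PC, (4) ⇒ (2) ⇒ (1) -/

/-- **Stacks 07PC, (4) ⇒ (2)**: let `R` be Noetherian and suppose that for every prime `𝔭` and
every finite extension `l` of `κ(𝔭) = Frac(R/𝔭)` (the printed condition (4) asks this for the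
finite purely inseparable ones) there is a finite `R/𝔭`-subalgebra `R' ⊆ l` with fraction field
`l` which is J-0. Then every domain `S` of finite type over `R` is J-0. Printed proof: with
`𝔭 = Ker(R → S)` and `K = Frac S` choose (Algebra, Lemma 04KM) a finite purely inseparable
`K'/K` and `κ(𝔭) ⊆ L ⊆ K'` finite purely inseparable with `K'/L` separable [formally smooth];
take `R' ⊆ L` as in (4) and `S' = Im(S ⊗_R R' → K')`; then `S'` is J-0 by 07PB and `S` is J-0 by
07PA. [cite: StacksProject, Tag 07PC] -/
theorem exists_ne_zero_forall_isRegularLocalRing_of_finiteType_of_forall_exists_finite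
    (R : Type u) [CommRing R] [IsNoetherianRing R]
    (H4 : ∀ (p : Ideal R) [p.IsPrime] (l : Type u) [Field l] [Algebra (R ⧸ p) l]
      [Algebra (FractionRing (R ⧸ p)) l] [IsScalarTower (R ⧸ p) (FractionRing (R ⧸ p)) l]
      [FiniteDimensional (FractionRing (R ⧸ p)) l],
      ∃ R' : Subalgebra (R ⧸ p) l, Module.Finite (R ⧸ p) R' ∧ IsFractionRing R' l ∧
        (∃ g : R', g ≠ 0 ∧ ∀ (Q : Ideal (R')) [Q.IsPrime], g ∉ Q →
        IsRegularLocalRing (Localization.AtPrime Q)))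
    (S : Type u) [CommRing S] [IsDomain S] [Algebra R S] [Algebra.FiniteType R S] :
    ∃ f : S, f ≠ 0 ∧ ∀ (Q : Ideal S) [Q.IsPrime], f ∉ Q →
      IsRegularLocalRing (Localization.AtPrime Q) := by
  classical
  -- `R₀ = R/𝔭 ⊆ S`
  set p : Ideal R := RingHom.ker (algebraMap R S) with hpdef
  haveI hp : p.IsPrime := RingHom.ker_isPrime _
  letI algR₀S : Algebra (R ⧸ p) S := (RingHom.kerLift (algebraMap R S)).toAlgebra
  haveI : IsScalarTower R (R ⧸ p) S := IsScalarTower.of_algebraMap_eq fun _ => rfl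
  haveI : FaithfulSMul (R ⧸ p) S := (faithfulSMul_iff_algebraMap_injective _ S).mpr
    (RingHom.kerLift_injective (algebraMap R S))
  haveI : Algebra.FiniteType (R ⧸ p) S := Algebra.FiniteType.of_restrictScalars_finiteType R _ S
  haveI : IsNoetherianRing S := Algebra.FiniteType.isNoetherianRing R S
  -- fraction fields `K₀ = Frac R₀ ⊆ K = Frac S`
  let K : Type u := FractionRing S
  let K₀ : Type u := FractionRing (R ⧸ p)
  haveI : FaithfulSMul (R ⧸ p) K := by
    rw [faithfulSMul_iff_algebraMap_injective, IsScalarTower.algebraMap_eq (R ⧸ p) S K]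
    exact (IsFractionRing.injective S K).comp (FaithfulSMul.algebraMap_injective _ S)
  letI : Algebra K₀ K := FractionRing.liftAlgebra (R ⧸ p) K
  have hfg : (⊤ : IntermediateField K₀ K).FG :=
    IntermediateField.fg_top_of_isFractionRing_of_finiteType_domain (R ⧸ p) S K₀ K
  -- separably generated after a finite (purely inseparable) extension of `K₀`
  obtain ⟨L, _, _, _, _, hfinKL, -, l, hlfin, -, hadj, -, hsmooth⟩ :=
    exists_purelyInseparable_isSeparablyGenerated K₀ K hfg
  haveI := hfinKL
  haveI := hlfin
  haveI := hsmooth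
  letI algR₀L : Algebra (R ⧸ p) L := ((algebraMap K₀ L).comp (algebraMap (R ⧸ p) K₀)).toAlgebra
  haveI : IsScalarTower (R ⧸ p) K₀ L := IsScalarTower.of_algebraMap_eq fun _ => rfl
  -- the finite J-0 cover `R' ⊆ l`
  obtain ⟨R', hR'fin, hR'frac, hR'J0⟩ := H4 p l
  haveI := hR'fin
  haveI := hR'frac
  -- `S → K → L`
  letI algSL : Algebra S L := ((algebraMap K L).comp (algebraMap S K)).toAlgebra
  haveI : IsScalarTower S K L := IsScalarTower.of_algebraMap_eq fun _ => rfl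
  haveI : IsScalarTower (R ⧸ p) S L := IsScalarTower.of_algebraMap_eq fun x => by
    show algebraMap K₀ L (algebraMap (R ⧸ p) K₀ x) = algebraMap K L (algebraMap S K (algebraMap _ S x))
    rw [← IsScalarTower.algebraMap_apply (R ⧸ p) S K, IsScalarTower.algebraMap_apply (R ⧸ p) K₀ K,
      ← IsScalarTower.algebraMap_apply K₀ K L]
  let φ : S →ₐ[R ⧸ p] L := IsScalarTower.toAlgHom (R ⧸ p) S L
  have hφinj : Function.Injective φ :=
    (algebraMap K L).injective.comp (IsFractionRing.injective S K)
  -- `R' → l → L`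
  haveI : IsScalarTower (R ⧸ p) l L := IsScalarTower.of_algebraMap_eq fun _ => rfl
  let ρ : R' →ₐ[R ⧸ p] L := (IsScalarTower.toAlgHom (R ⧸ p) l L).comp R'.val
  have hρ : ∀ r : R', ρ r = algebraMap l L (r : l) := fun _ => rfl
  have hρinj : Function.Injective ρ := (algebraMap l L).injective.comp Subtype.val_injective
  -- generators
  obtain ⟨s, hs⟩ := ‹Algebra.FiniteType (R ⧸ p) S›.out
  obtain ⟨b, hb⟩ := Module.Finite.fg_top (R := R ⧸ p) (M := R')
  let bL : Finset L := b.image ρ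
  let T : Finset L := s.image φ
  let C' : Subalgebra (R ⧸ p) L := Algebra.adjoin (R ⧸ p) ((bL : Set L) ∪ (T : Set L))
  have hφC' : ∀ c : S, φ c ∈ C' := by
    intro c
    have hc : c ∈ Algebra.adjoin (R ⧸ p) (s : Set S) := hs ▸ Algebra.mem_top
    have h1 : φ c ∈ (Algebra.adjoin (R ⧸ p) (s : Set S)).map φ := ⟨c, hc, rfl⟩
    rw [AlgHom.map_adjoin] at h1
    refine Algebra.adjoin_mono ?_ h1
    rw [← Finset.coe_image]
    exact Set.subset_union_right
  have hρC' : ∀ r : R', ρ r ∈ C' := by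
    intro r
    have hr : r ∈ Submodule.span (R ⧸ p) (b : Set R') := hb ▸ Submodule.mem_top
    have h1 := Submodule.apply_mem_span_image_of_mem_span ρ.toLinearMap hr
    refine (Submodule.span_le.mpr ?_ :
      Submodule.span (R ⧸ p) _ ≤ Subalgebra.toSubmodule C') h1
    intro x hx
    refine Algebra.subset_adjoin (Set.mem_union_left _ ?_)
    simp only [bL, Finset.coe_image]
    exact hx
  -- `C'` as an `S`-algebra and as an `R'`-algebra
  let ψ : S →+* C' := (φ : S →+* L).codRestrict C' hφC'
  letI algSC' : Algebra S C' := ψ.toAlgebra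
  let ι : R' →+* C' := (ρ : R' →+* L).codRestrict C' hρC'
  letI algR'C' : Algebra R' C' := ι.toAlgebra
  haveI : IsScalarTower S C' L := IsScalarTower.of_algebraMap_eq fun _ => rfl
  haveI : IsScalarTower R' C' L := IsScalarTower.of_algebraMap_eq fun _ => rfl
  haveI : IsScalarTower R' l L := IsScalarTower.of_algebraMap_eq fun _ => rfl
  haveI : IsScalarTower (R ⧸ p) S C' := IsScalarTower.of_algebraMap_eq fun x => Subtype.ext (by
    show algebraMap (R ⧸ p) L x = φ (algebraMap (R ⧸ p) S x)
    exact (φ.commutes x).symm)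
  haveI : IsScalarTower (R ⧸ p) R' C' := IsScalarTower.of_algebraMap_eq fun x => Subtype.ext (by
    show algebraMap (R ⧸ p) L x = ρ (algebraMap (R ⧸ p) R' x)
    exact (ρ.commutes x).symm)
  haveI : FaithfulSMul S C' := (faithfulSMul_iff_algebraMap_injective S C').mpr
    fun x y h => hφinj (congrArg Subtype.val h)
  haveI : FaithfulSMul R' C' := (faithfulSMul_iff_algebraMap_injective R' C').mpr
    fun x y h => by
      have h' := congrArg Subtype.val h
      exact hρinj h'
  -- finiteness
  haveI : Algebra.FiniteType (R ⧸ p) C' :=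
    C'.fg_iff_finiteType.mp ⟨bL ∪ T, by rw [Finset.coe_union]⟩
  haveI : Algebra.FiniteType S C' := Algebra.FiniteType.of_restrictScalars_finiteType (R ⧸ p) S C'
  haveI : Algebra.FiniteType R' C' := Algebra.FiniteType.of_restrictScalars_finiteType (R ⧸ p) R' C'
  haveI : Algebra.IsIntegral (R ⧸ p) R' := Algebra.IsIntegral.of_finite _ _
  haveI : Algebra.IsIntegral S C' := by
    refine ⟨fun x => ?_⟩
    have hsub : C' ≤ (integralClosure S L).restrictScalars (R ⧸ p) := by
      refine Algebra.adjoin_le ?_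
      rintro x (hx | hx)
      · simp only [bL, Finset.coe_image] at hx
        obtain ⟨y, -, rfl⟩ := hx
        have h1 : IsIntegral (R ⧸ p) (ρ y) :=
          (Algebra.IsIntegral.isIntegral (R := R ⧸ p) y).map ρ
        exact h1.tower_top
      · simp only [T, Finset.coe_image] at hx
        obtain ⟨c, -, rfl⟩ := hx
        exact isIntegral_algebraMap (R := S) (A := L)
    have hxL : IsIntegral S (x : L) := hsub x.2
    exact (isIntegral_algHom_iff (IsScalarTower.toAlgHom S C' L) Subtype.val_injective).mp hxL
  haveI : Module.Finite S C' := Algebra.IsIntegral.finite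
  -- `L = Frac C'`
  haveI : FaithfulSMul C' L := (faithfulSMul_iff_algebraMap_injective C' L).mpr
    Subtype.val_injective
  haveI : Algebra.IsAlgebraic K L := Algebra.IsAlgebraic.of_finite K L
  haveI : IsFractionRing C' L := by
    refine IsFractionRing.of_field (R := C') (K := L) fun z => ?_
    have halg : ∀ x ∈ ((l : Set L)), IsAlgebraic K x := fun x _ =>
      Algebra.IsAlgebraic.isAlgebraic x
    have hz : z ∈ Algebra.adjoin K (l : Set L) := by
      rw [← IntermediateField.adjoin_toSubalgebra_of_isAlgebraic halg,
        IntermediateField.mem_toSubalgebra, hadj]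
      exact IntermediateField.mem_top
    suffices h : ∃ x y : C', y ≠ 0 ∧ z = algebraMap C' L x / algebraMap C' L y by
      obtain ⟨x, y, -, h⟩ := h
      exact ⟨x, y, h⟩
    refine Algebra.adjoin_induction (p := fun z _ => ∃ x y : C', y ≠ 0 ∧
      z = algebraMap C' L x / algebraMap C' L y) ?_ ?_ ?_ ?_ hz
    · intro x hx
      obtain ⟨r₁, r₂, hr₂, hr⟩ := IsFractionRing.div_surjective (A := R') (⟨x, hx⟩ : l)
      refine ⟨ι r₁, ι r₂, fun h => ?_, ?_⟩
      · exact nonZeroDivisors.ne_zero hr₂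
          ((map_eq_zero_iff (ρ : R' →+* L) hρinj).mp (congrArg Subtype.val h))
      · have h1 : (x : L) = algebraMap l L (⟨x, hx⟩ : l) := rfl
        rw [h1, ← hr, map_div₀]
        rfl
    · intro κ
      obtain ⟨a, d, hd, rfl⟩ := IsFractionRing.div_surjective (A := S) κ
      refine ⟨ψ a, ψ d, fun h => ?_, ?_⟩
      · have : d = 0 := (injective_iff_map_eq_zero ψ).mp
          ((faithfulSMul_iff_algebraMap_injective S C').mp inferInstance) d h
        exact nonZeroDivisors.ne_zero hd this
      · rw [map_div₀]
        rfl
    · rintro x y - - ⟨a, c, hc, rfl⟩ ⟨a', c', hc', rfl⟩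
      refine ⟨a * c' + a' * c, c * c', mul_ne_zero hc hc', ?_⟩
      have hcL : (algebraMap C' L c) ≠ 0 := fun h => hc (Subtype.val_injective h)
      have hc'L : (algebraMap C' L c') ≠ 0 := fun h => hc' (Subtype.val_injective h)
      rw [div_add_div _ _ hcL hc'L, map_add, map_mul, map_mul, map_mul]
      ring
    · rintro x y - - ⟨a, c, hc, rfl⟩ ⟨a', c', hc', rfl⟩
      refine ⟨a * a', c * c', mul_ne_zero hc hc', ?_⟩
      rw [div_mul_div_comm, map_mul, map_mul]
  -- J-0 for `C'` over `R'` (07PB), then descend to `S` (07PA)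
  haveI : IsNoetherianRing R' := Algebra.FiniteType.isNoetherianRing (R ⧸ p) R'
  have hJ0' := exists_ne_zero_forall_isRegularLocalRing_of_finiteType_formallySmooth R' C' l L hR'J0
  exact exists_ne_zero_forall_isRegularLocalRing_of_finite S C' hJ0'

/-- **Stacks 07PC, (2) ⇒ (1), with (4) ⇒ (2): a Noetherian ring admitting finite J-0 covers of
all finite extensions of its residue fields `κ(𝔭)` is J-2** ((2) ⇒ (1) is Nagata's criterion
07P9 = Matsumura Thm. 24.4, `Matsumura1987_24_4`, applied to the domains `B/P` of finite type
over `R`). [cite: StacksProject, Tag 07PC] -/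
theorem isJ2Ring_of_forall_exists_finite (R : Type u) [CommRing R] [IsNoetherianRing R]
    (H4 : ∀ (p : Ideal R) [p.IsPrime] (l : Type u) [Field l] [Algebra (R ⧸ p) l]
      [Algebra (FractionRing (R ⧸ p)) l] [IsScalarTower (R ⧸ p) (FractionRing (R ⧸ p)) l]
      [FiniteDimensional (FractionRing (R ⧸ p)) l],
      ∃ R' : Subalgebra (R ⧸ p) l, Module.Finite (R ⧸ p) R' ∧ IsFractionRing R' l ∧
        (∃ g : R', g ≠ 0 ∧ ∀ (Q : Ideal (R')) [Q.IsPrime], g ∉ Q →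
        IsRegularLocalRing (Localization.AtPrime Q))) :
    IsJ2Ring R := by
  refine ⟨‹_›, fun B _ _ hB => ?_⟩
  haveI := hB
  haveI : IsNoetherianRing B := Algebra.FiniteType.isNoetherianRing R B
  refine Matsumura1987_24_4 fun P _ => ?_
  haveI : IsDomain (B ⧸ P) := Ideal.Quotient.isDomain P
  haveI : Algebra.FiniteType R (B ⧸ P) := hB.trans inferInstance
  obtain ⟨f, hf0, hf⟩ :=
    exists_ne_zero_forall_isRegularLocalRing_of_finiteType_of_forall_exists_finite R H4 (B ⧸ P)
  refine ⟨PrimeSpectrum.basicOpen f, (PrimeSpectrum.basicOpen f).isOpen,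
    ⟨⟨⊥, Ideal.isPrime_bot⟩, ?_⟩, fun Q hQ => ?_⟩
  · rw [SetLike.mem_coe, PrimeSpectrum.mem_basicOpen]
    exact fun h => hf0 ((Submodule.mem_bot (R := B ⧸ P)).mp h)
  · rw [mem_regularLocus]
    exact hf Q.asIdeal hQ

end Literature.AlgebraicGeometry.Resolution
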